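import Summits.ResolutionOfSingularities.ResolutionOfSingularities.Theorems.FrobeniusClosingPatchingRelPerfectDepthOneDictionaryStep
import HarnessLib

/-!
# Crux `PatchingRelPerfect` (stmt-ResolutionOfSingularities-16161), chain w52 — R4 support:
# the scheme-level dictionary step WITH EXPONENT `μ` (`D1^μ`)

[OURS · L1 W5.2 · rung tool] CHAIN.md v1.5 §1 (A): the next rung R4 = r-d2¹ runs «on the SAME dictionary with a
two-layer package». This file proves the dictionary step of `…DepthOneDictionaryStep.lean` (D1, exponent `1`,
p495681) for an arbitrary exponent `μ`, with the FORMAT given explicitly (no `∃`) so that the order condition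
`K ≤ Ĉ^μ` along the centre — which for `μ ≥ 2` is a condition on the ambient scheme, not readable on `E`
alone — can be stated:

* `DepthOne.dictionaryStep_pow` — `S` regular local, `i : E ⟶ X` a closed immersion of the regular `E` into
  the Noetherian regular `X` with `𝓘_E = i.ker` an effective Cartier divisor, `E` over the closed point,
  `g : X ⟶ Spec S` a blowing up cosupported in the closed point, FORMAT `I𝒪_X = M · K` with `M` an effective
  Cartier ideal, `𝓘_E^μ ≤ K` and `K|_E = 𝔟`; one step `τ : E' ⟶ E` blowing up a centre `C` with `V(C)`
  regular, `K ≤ (C.map i)^μ` and `𝔟𝒪_{E'} = (C𝒪_{E'})^μ · 𝔟'`. Then, with `σ : X' = Bl_{C.map i} X ⟶ X`,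
  `i' = Bl(i)`, `M' = σ^*M · 𝓘_{exc}^μ`, `K' = (σ^*K : 𝓘_{exc}^μ)` (the controlled transform with exponent
  `μ`), every invariant field is re-established: `X'` Noetherian regular, `E'` regular, `i'` a closed
  immersion with `𝓘_{E'}` effective Cartier and `𝓘_{exc} · 𝓘_{E'} = σ^*𝓘_E`, `E' ↦ 𝔪`, `σ ≫ g` cosupported in
  `{𝔪}`, `M'` effective Cartier, `𝓘_{E'}^μ ≤ K'`, `K'|_{E'} = 𝔟'`, `I𝒪_{X'} = M' · K'`.

* `DepthOne.dictionaryStep_pow_controlledTransform` — the same with the threefold side READ OFF: `𝔟 := K|_E`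
  and `K'|_{E'} = controlledTransform τ C (K|_E) μ` (plan-1 g6 STEER (3') «D_ℓ DictionaryStepPow»: the
  weight-`μ` initial ideal transports along the `E`-blow-up as its controlled transform of exponent `μ`).

Tools: BGMW Lemma 3.2.1 with exponent (`IsBlowup.pow_mul_controlledTransform_eq`), GW 13.91 (1) / 13.96 (2)
(`IsBlowup.strictTransformHom`, `IsBlowup.isClosedImmersion_of_comp_eq`, `IsBlowup.ker_strictTransformHom_of_isRegular`),
Liu 8.1.19 (a) (`IsBlowup.isRegular_of_isRegular_subscheme`), cancellation of effective Cartier divisors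
(`IsEffectiveCartier.eq_of_mul_eq_mul`) and the D1 kit `DepthOne.*`. Fact-free; the centres with
`ν_C(K) < μ` (CHAIN v1.5a «interleaving points») are NOT treated here. Nothing here is a statement of the
manuscript under review.

## References

* E. Bierstone, D. Grigoriev, P. Milman, J. Włodarczyk (2011), §3.2 Lemma 3.2.1. [BierstoneGrigorievMilmanWlodarczyk2011]
* U. Görtz, T. Wedhorn, *Algebraic Geometry I* (2020), Prop. 13.91 (1), 13.96 (2). [GortzWedhorn2020]
* J. Kollár, *Lectures on Resolution of Singularities* (2007), (3.111) Step 3. [Kollar2007]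
* Q. Liu (2002), Thm. 8.1.19 (a). [Liu2002]
-/

-- `Summit.<Summit>.<Sub>.Theorems` with `Sub = Summit` (single-conjunct summit, D-0017)
set_option linter.dupNamespace false

noncomputable section

open CategoryTheory CategoryTheory.Limits AlgebraicGeometry TopologicalSpace
open Literature.AlgebraicGeometry.Resolution
open IsLocalRing

namespace Summit.ResolutionOfSingularities.ResolutionOfSingularities.Theorems

universe u

namespace DepthOne

/-- **D1^μ — the dictionary step with exponent `μ`** (explicit format): see the module docstring. For
`μ = 1` and `K ≤ C.map i` derived from `𝔟 ≤ C` this is `dictionaryStep` (p495681).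
[cite: BierstoneGrigorievMilmanWlodarczyk2011, §3.2 Lemma 3.2.1] [cite: GortzWedhorn2020, Prop. 13.91 (1), Prop. 13.96 (2)]
[cite: Kollar2007, (3.111) Step 3] [cite: Liu2002, Thm. 8.1.19 (a)] -/
theorem dictionaryStep_pow {S : Type u} [CommRing S] [IsRegularLocalRing S] (I : Ideal S) (μ : ℕ)
    {E X : Scheme.{u}} (i : E ⟶ X) (g : X ⟶ Spec (.of S)) (𝔟 : E.IdealSheafData)
    [IsNoetherian X] (hX : Scheme.IsRegular X) (hE : Scheme.IsRegular E)
    [IsClosedImmersion i] (hiE : IsEffectiveCartier i.ker)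
    (hEpt : ∀ e : E, g.base (i.base e) = IsLocalRing.closedPoint S)
    (hg : ∃ K₀ : (Spec (.of S)).IdealSheafData, IsBlowup g K₀ ∧
      (K₀.support : Set (Spec (.of S))) ⊆ {IsLocalRing.closedPoint S})
    (M K : X.IdealSheafData) (hM : IsEffectiveCartier M) (hkerK : i.ker ^ μ ≤ K) (hKE : K.comap i = 𝔟)
    (hIMK : (affineBlowup.idealSheaf I).comap g = M * K)
    {E' : Scheme.{u}} (τ : E' ⟶ E) (C : E.IdealSheafData) (𝔟' : E'.IdealSheafData)
    (hC : Scheme.IsRegular C.subscheme) (hKC : K ≤ (C.map i) ^ μ) (hτ : IsBlowup τ C)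
    (hctrl : 𝔟.comap τ = C.comap τ ^ μ * 𝔟') :
    ∃ (X' : Scheme.{u}) (σ : X' ⟶ X) (hσ : IsBlowup σ (C.map i))
      (hτ' : IsBlowup τ ((C.map i).comap i)),
      IsNoetherian X' ∧ Scheme.IsRegular X' ∧ Scheme.IsRegular E' ∧
      IsClosedImmersion (hσ.strictTransformHom hτ') ∧
      IsEffectiveCartier (hσ.strictTransformHom hτ').ker ∧
      (C.map i).comap σ * (hσ.strictTransformHom hτ').ker = i.ker.comap σ ∧
      (∀ e : E', (σ ≫ g).base ((hσ.strictTransformHom hτ').base e) = IsLocalRing.closedPoint S) ∧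
      (∃ K' : (Spec (.of S)).IdealSheafData, IsBlowup (σ ≫ g) K' ∧
        (K'.support : Set (Spec (.of S))) ⊆ {IsLocalRing.closedPoint S}) ∧
      IsEffectiveCartier (M.comap σ * (C.map i).comap σ ^ μ) ∧
      (hσ.strictTransformHom hτ').ker ^ μ ≤ controlledTransform σ (C.map i) K μ ∧
      (controlledTransform σ (C.map i) K μ).comap (hσ.strictTransformHom hτ') = 𝔟' ∧
      (affineBlowup.idealSheaf I).comap (σ ≫ g) =
        (M.comap σ * (C.map i).comap σ ^ μ) * controlledTransform σ (C.map i) K μ := by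
  -- the centre pushed into `X`
  set Ch : X.IdealSheafData := C.map i with hCh
  have hkerCh : i.ker ≤ Ch := ker_le_map_centre i C
  have hChE : Ch.comap i = C := comap_map_centre i C
  have hChreg : Scheme.IsRegular Ch.subscheme := isRegular_subscheme_map i C hC
  -- blow `X` up along `Ch`
  obtain ⟨X', σ, hσ⟩ := exists_isBlowup X Ch
  have hτ' : IsBlowup τ (Ch.comap i) := by rw [hChE]; exact hτ
  refine ⟨X', σ, hσ, hτ', ?_⟩
  -- the strict-transform morphism
  set i' : E' ⟶ X' := hσ.strictTransformHom hτ' with hi'def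
  have hsq : i' ≫ σ = τ ≫ i := hσ.strictTransformHom_comp hτ'
  haveI hi' : IsClosedImmersion i' := hσ.isClosedImmersion_of_comp_eq hτ' hsq
  -- `X'` is Noetherian and regular, `E'` is regular
  haveI : IsProper σ := hσ.isProper
  haveI : IsLocallyNoetherian X' := LocallyOfFiniteType.isLocallyNoetherian σ
  haveI : CompactSpace X' := QuasiCompact.compactSpace_of_compactSpace σ
  have hX'N : IsNoetherian X' := {}
  have hX'reg : Scheme.IsRegular X' := hσ.isRegular_of_isRegular_subscheme hX hChreg
  haveI : IsLocallyNoetherian E := LocallyOfFiniteType.isLocallyNoetherian i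
  have hE'reg : Scheme.IsRegular E' := hτ.isRegular_of_isRegular_subscheme hE hC
  -- the ideal of the strict transform
  have hker : i'.ker = controlledTransform σ Ch i.ker 1 :=
    hσ.ker_strictTransformHom_of_isRegular hX hChreg hτ' hkerCh (isRegular_subscheme_ker i hE)
  have hexc : IsEffectiveCartier (Ch.comap σ) := hσ.isEffectiveCartier
  have hkerfac : Ch.comap σ * i'.ker = i.ker.comap σ := by
    rw [hker]; exact hσ.comap_mul_controlledTransform_one hkerCh
  have hkerE' : IsEffectiveCartier i'.ker := by
    have h2 : IsEffectiveCartier (i.ker.comap σ) := hiE.comap_of_isBlowup hσ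
    rw [← hkerfac] at h2
    exact h2.of_mul_right
  -- the controlled transform with exponent `μ`
  have hKK' : Ch.comap σ ^ μ * controlledTransform σ Ch K μ = K.comap σ :=
    hσ.pow_mul_controlledTransform_eq (by
      rw [← comap_pow]; exact Scheme.IdealSheafData.comap_mono (f := σ) hKC)
  refine ⟨hX'N, hX'reg, hE'reg, hi', hkerE', hkerfac, ?_, ?_, (hM.comap_of_isBlowup hσ).mul (hexc.pow μ),
    ?_, ?_, ?_⟩
  · -- `E'` lies over the closed point
    intro e
    have : (i' ≫ σ).base e = (τ ≫ i).base e := by rw [hsq]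
    simp only [Scheme.Hom.comp_base, TopCat.coe_comp, Function.comp_apply] at this ⊢
    rw [this]
    exact hEpt (τ.base e)
  · -- `σ ≫ g` is a blowing up cosupported in the closed point
    obtain ⟨K₀, hgK, hKsupp⟩ := hg
    have hChsupp : (Ch.support : Set X) ⊆ g.base ⁻¹' {IsLocalRing.closedPoint S} := by
      intro x hx
      obtain ⟨e, rfl⟩ := support_map_subset_range i C hx
      exact hEpt e
    obtain ⟨Q, hQ, hQsupp⟩ := hgK.exists_isBlowup_comp_supported g K₀ σ Ch
      {IsLocalRing.closedPoint S} hKsupp hσ hChsupp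
    exact ⟨Q, hQ, hQsupp⟩
  · -- `𝓘_{E'}^μ ≤ K'`: cancel `𝓘_{exc}^μ` in `𝓘_{exc}^μ 𝓘_{E'}^μ = σ^*(𝓘_E^μ) ≤ σ^*K`
    rw [controlledTransform, le_colon_iff]
    calc Ch.comap σ ^ μ * i'.ker ^ μ = (Ch.comap σ * i'.ker) ^ μ := by rw [mul_pow]
      _ = (i.ker ^ μ).comap σ := by rw [hkerfac, comap_pow]
      _ ≤ K.comap σ := Scheme.IdealSheafData.comap_mono (f := σ) hkerK
  · -- `K'|_{E'} = 𝔟'`: cancel the effective Cartier divisor `(C𝒪_{E'})^μ`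
    apply (hτ.isEffectiveCartier.pow μ).eq_of_mul_eq_mul
    have h1 : (Ch.comap σ).comap i' = C.comap τ := by
      rw [← Scheme.IdealSheafData.comap_comp, hsq, Scheme.IdealSheafData.comap_comp, hChE]
    have h2 : (K.comap σ).comap i' = 𝔟.comap τ := by
      rw [← Scheme.IdealSheafData.comap_comp, hsq, Scheme.IdealSheafData.comap_comp, hKE]
    rw [← hctrl, ← h2, ← hKK', comap_mul, comap_pow, h1]
  · -- `I𝒪_{X'} = σ^*M · 𝓘_{exc}^μ · K'`
    rw [Scheme.IdealSheafData.comap_comp, hIMK, comap_mul, ← hKK', mul_assoc]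


/-- **D1^μ, controlled-transform form** (plan-1 g6 STEER 04:36:13Z (3') «D_ℓ DictionaryStepPow»): as
`dictionaryStep_pow`, with the threefold side read off rather than prescribed — `𝔟 := K|_E` and the new
threefold ideal is **the controlled transform `τᶜ(K|_E, μ)` of exponent `μ`** along the blowing up `τ` of
`E` at `C`: `K'|_{E'} = controlledTransform τ C (K.comap i) μ` (the weight-`μ` initial ideal transports
along the `E`-blow-up). [cite: BierstoneGrigorievMilmanWlodarczyk2011, §3.2 Lemma 3.2.1]
[cite: GortzWedhorn2020, Prop. 13.91 (1), Prop. 13.96 (2)] -/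
theorem dictionaryStep_pow_controlledTransform {S : Type u} [CommRing S] [IsRegularLocalRing S]
    (I : Ideal S) (μ : ℕ)
    {E X : Scheme.{u}} (i : E ⟶ X) (g : X ⟶ Spec (.of S))
    [IsNoetherian X] (hX : Scheme.IsRegular X) (hE : Scheme.IsRegular E)
    [IsClosedImmersion i] (hiE : IsEffectiveCartier i.ker)
    (hEpt : ∀ e : E, g.base (i.base e) = IsLocalRing.closedPoint S)
    (hg : ∃ K₀ : (Spec (.of S)).IdealSheafData, IsBlowup g K₀ ∧
      (K₀.support : Set (Spec (.of S))) ⊆ {IsLocalRing.closedPoint S})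
    (M K : X.IdealSheafData) (hM : IsEffectiveCartier M) (hkerK : i.ker ^ μ ≤ K)
    (hIMK : (affineBlowup.idealSheaf I).comap g = M * K)
    {E' : Scheme.{u}} (τ : E' ⟶ E) (C : E.IdealSheafData)
    (hC : Scheme.IsRegular C.subscheme) (hKC : K ≤ (C.map i) ^ μ) (hτ : IsBlowup τ C) :
    ∃ (X' : Scheme.{u}) (σ : X' ⟶ X) (hσ : IsBlowup σ (C.map i))
      (hτ' : IsBlowup τ ((C.map i).comap i)),
      IsNoetherian X' ∧ Scheme.IsRegular X' ∧ Scheme.IsRegular E' ∧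
      IsClosedImmersion (hσ.strictTransformHom hτ') ∧
      IsEffectiveCartier (hσ.strictTransformHom hτ').ker ∧
      (C.map i).comap σ * (hσ.strictTransformHom hτ').ker = i.ker.comap σ ∧
      (∀ e : E', (σ ≫ g).base ((hσ.strictTransformHom hτ').base e) = IsLocalRing.closedPoint S) ∧
      (∃ K' : (Spec (.of S)).IdealSheafData, IsBlowup (σ ≫ g) K' ∧
        (K'.support : Set (Spec (.of S))) ⊆ {IsLocalRing.closedPoint S}) ∧
      IsEffectiveCartier (M.comap σ * (C.map i).comap σ ^ μ) ∧
      (hσ.strictTransformHom hτ').ker ^ μ ≤ controlledTransform σ (C.map i) K μ ∧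
      (controlledTransform σ (C.map i) K μ).comap (hσ.strictTransformHom hτ') =
        controlledTransform τ C (K.comap i) μ ∧
      (affineBlowup.idealSheaf I).comap (σ ≫ g) =
        (M.comap σ * (C.map i).comap σ ^ μ) * controlledTransform σ (C.map i) K μ := by
  -- the threefold side: `K|_E 𝒪_{E'} = (C𝒪_{E'})^μ · τᶜ(K|_E, μ)` (BGMW 3.2.1 with exponent `μ` on `E`)
  have hle : (K.comap i).comap τ ≤ C.comap τ ^ μ := by
    have h1 : K.comap i ≤ C ^ μ := by
      have h : K.comap i ≤ ((C.map i) ^ μ).comap i := Scheme.IdealSheafData.comap_mono (f := i) hKC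
      rwa [comap_pow, comap_map_centre i C] at h
    have h : (K.comap i).comap τ ≤ (C ^ μ).comap τ := Scheme.IdealSheafData.comap_mono (f := τ) h1
    rwa [comap_pow] at h
  have hctrl : (K.comap i).comap τ = C.comap τ ^ μ * controlledTransform τ C (K.comap i) μ :=
    (hτ.pow_mul_controlledTransform_eq hle).symm
  exact dictionaryStep_pow I μ i g (K.comap i) hX hE hiE hEpt hg M K hM hkerK rfl hIMK τ C
    (controlledTransform τ C (K.comap i) μ) hC hKC hτ hctrl

end DepthOne

end Summit.ResolutionOfSingularities.ResolutionOfSingularities.Theorems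

end
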